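import Summits.Langlands.Langlands.Theses.SkinnerWilesDefectOne
import Summits.Langlands.Langlands.Theorems.SkinnerWilesDefectOneProModularOrdinaryClassicalCentralDiamondWeight
import Summits.Langlands.Langlands.Theorems.SkinnerWilesDefectOneProModularOrdinaryClassicalSatakeDictionary
import Summits.Langlands.Langlands.Theorems.SkinnerWilesDefectOneProModularOrdinaryClassicalDominantGlue
import Summits.Langlands.Langlands.Theorems.SkinnerWilesDefectOneProModularOrdinaryClassicalDominantPointsClassical
import Literature.NumberTheory.Automorphic.OrdinaryCompletedCohomologyGL
import Literature.NumberTheory.Automorphic.BianchiOrdinaryClassicality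

/-!
# Route `SkinnerWilesDefectOne`, crux `ProModularOrdinaryClassical` (stmt-Langlands-12921): the EXIT from an
# ordinary point — the composed, transfer-free half of the line `top-degree-exact-control`

Helper file (`--supports stmt-Langlands-12921`) of the checked skeleton
`Cruxes/ProModularOrdinaryClassical/Lines/top_degree_exact_control.lean` (rev 4, lead
prover-line-stmt-Langlands-12921-c1-0).  The crux `ProModularOrdinaryClassical` (THE EXIT of the route) enters through
a point of the FULL completed-cohomology Hecke algebra `𝕋(K^p)` (`IsPadicallyAutomorphic`) and is, as typed, the
open Galois ⇒ Hecke ordinary local–global compatibility for `GL₂` over an imaginary quadratic field composed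
with a CLASSICALITY statement for dominant points of Hida's ordinary big Hecke algebra `𝕋^{S,ord}(𝒰)`.  The
second half is what the line's four LANDED stubs prove (modulo the three printed Bianchi facts of
`Literature/NumberTheory/Automorphic/BianchiOrdinaryClassicality.lean`): this file composes them ONCE, into the
two statements a route retyped through Hida's ordinary algebra would consume verbatim —

* `classical_of_ordinaryPoint`: for `𝒰` maximal above `p` and a continuous `ℚ̄_p`-point `x` of
  `𝕋^{S,ord}(𝒰)` associated with an irreducible `ρ` that is Galois-ordinary of parallel weight `k ≥ 2`
  (exponent `m > 0`) at every `v ∣ p`, whose slot-`0` diamond character has finite order on the global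
  units above `p` (the ORDERING bit: `x` is the dominant refinement), there is an L-algebraic cuspidal `π`
  of `GL₂(𝔸_F)` with the summit's Satake–Frobenius matching at almost all places;
* `ordinarilyProModularOrdinaryClassical`: the crux with its pro-modularity hypothesis
  `∃ 𝒰, 𝒰.IsPadicallyAutomorphic ρ` REPLACED by "ordinarily `p`-adically automorphic at a level maximal above
  `p`, by a point with finite-order slot `0`" — i.e. `ProModularOrdinaryClassical` minus exactly the open
  transfer core (OF⁺) (`stub_ordinaryFactorisationIwahori` ∘ `stub_slopeZeroFactorisation` of the skeleton).

Both are CONDITIONAL on the named facts `hidaControl_dominantOrdinaryPoint` (Hida1994AIF Thm. 2.2/3.1/3.2,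
KhareThorne2017 §6.4–6.5), `bianchi_interiorEigenclass_isCuspidal` (Harder1987, Franke1998 Thm. 18) and
`bianchi_boundaryEigensystem_isReducible` (Harder1987; KhareThorne2017 proof of Thm. 6.23), taken as
hypotheses (D-0014 named facts; the gate records a conditional result).  Chain: `stub_centralDiamondWeight`
(centre of the diamond character has weight `2 - k`) + `stub_dominantOfCentralAndSlotZero` (glue) ⇒
`HasDominantDiamondWeight x k`; `stub_dominantPointsClassical` ⇒ a regular algebraic cuspidal `π₀` whose Satake
parameters give `x(T_{w,1}), x(T_{w,2})`; `stub_satakeDictionary` ⇒ the L-algebraic `π = (π₀ ⊗ ω⁻¹) ⊗ |det|^{1/2}`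
with `SatakeFrobCompatibleAt ι π ρ` a.e.  Pure logic over the landed files; no new mathematics.
-/

noncomputable section

namespace Summit.Langlands.Langlands.Cruxes.ProModularOrdinaryClassical.TopDegreeExactControl

set_option linter.dupNamespace false

open Summit.Langlands.Langlands.Theses.SkinnerWilesDefectOne
open Literature.NumberTheory.Automorphic Literature.NumberTheory.GaloisRepresentations
open Literature.NumberTheory.Automorphic.BigHeckeGLn
open NumberField IsDedekindDomain Filter

/-- **Classicality of a slot-`0`-finite ordinary point associated with an irreducible Galois-ordinary `ρ`**
(the transfer-free half of the crux, composed from the four landed stubs of the line `top-degree-exact-control`;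
conditional on the three printed Bianchi facts).  For `F` imaginary quadratic, `p` odd, `𝒰` maximal above `p`,
`x : 𝕋^{S,ord}(𝒰) → ℚ̄_p` continuous and associated with the irreducible `ρ`, `ρ` ordinary of parallel weight
`k ≥ 2` with exponent `m > 0` at every `v ∣ p`, and `u ↦ ∏_{v∣p} x(⟨diag(û_v,1)⟩_v)` of finite order: there is an
L-algebraic cuspidal `π` on `GL₂(𝔸_F)` with `SatakeFrobCompatibleAt ι π ρ v` for almost all `v`. [folklore] -/
theorem classical_of_ordinaryPoint : Literature.NumberTheory.Automorphic.hidaControl_dominantOrdinaryPoint → Literature.NumberTheory.Automorphic.bianchi_interiorEigenclass_isCuspidal → Literature.NumberTheory.Automorphic.bianchi_boundaryEigensystem_isReducible → ∀ (F : Type) [Field F] [NumberField F], NumberField.IsTotallyComplex F → Module.finrank ℚ F = 2 → ∀ (p : ℕ) [Fact p.Prime], p ≠ 2 → ∀ (hcpt : Literature.NumberTheory.Automorphic.isCompact_glFiniteIntegralLevel 2 F) (ι : PadicAlgCl p ≃+* ℂ) (ρ : Literature.NumberTheory.GaloisRepresentations.FramedGaloisRep F (PadicAlgCl p) 2) (𝒰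 : Literature.NumberTheory.Automorphic.BigHeckeGLn.TameLevel 2 F p) (x : Literature.NumberTheory.Automorphic.OrdinaryHeckeAlgebraGLn 𝒰 →+* PadicAlgCl p) (k m : ℕ), ρ.toGaloisRep.IsIrreducible → 𝒰.IsMaximalAbove → Continuous x → 𝒰.IsOrdAssociated x ρ → 2 ≤ k → 0 < m → (∀ v : IsDedekindDomain.HeightOneSpectrum (NumberField.RingOfIntegers F), (p : NumberField.RingOfIntegers F) ∈ v.asIdeal → ρ.IsOrdinaryOfWeightAt p v k m) → (∃ N : ℕ, 0 < N ∧ ∀ (u : NumberField.RingOfIntegers F) (û : ∀ v : IsDedekindDomain.HeightOneSpectrum (NumberField.RingOfIntegers F), (p : NumberField.RingOfIntegers F) ∈ v.asIdeal → (v.adicCompletionIntegers F)ˣ), (∀ (v : IsDedekindDomain.HeightOneSpectrum (NumberField.RingOfIntegers F)) (hv : (p : NumberField.RingOfIntegers F) ∈ v.asIdeal), ((û v hv : v.adicCompletionIntegers F) : v.adicCompletion F) = algebraMap F (v.adicCompletion F) (u : F)) → (∏ᶠ v : {v : IsDedekindDomain.HeightOneSpectrum (NumberField.RingOfIntegers F)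 // (p : NumberField.RingOfIntegers F) ∈ v.asIdeal}, x (𝒰.ordDiamond v.2 (Pi.mulSingle (0 : Fin 2) (û v.1 v.2)))) ^ N = 1) → ∃ π : Literature.NumberTheory.Automorphic.CuspidalAutomorphicRepData 2 F hcpt, π.1.IsLAlgebraic ∧ ∀ᶠ v in Filter.cofinite, Summit.Langlands.SatakeFrobCompatibleAt ι π.1 ρ v := by
  intro hA hB hC F _ _ hF hdeg p _ hp hcpt ι ρ 𝒰 x k m hirr h𝒰 hx hass hk hm hv hslot
  have hcen := stub_centralDiamondWeight F hF hdeg p hp ρ 𝒰 x k m hirr h𝒰 hx hass hk hm hv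
  have hdom : 𝒰.HasDominantDiamondWeight x k :=
    stub_dominantOfCentralAndSlotZero F p 𝒰 x k h𝒰 hcen hslot
  obtain ⟨π₀, hreg, hmatch⟩ :=
    stub_dominantPointsClassical hA hB hC F hF hdeg p hp hcpt ι ρ 𝒰 x k m hirr h𝒰 hx hass hk hm hv hdom
  exact stub_satakeDictionary F hF hdeg p hp hcpt ι ρ 𝒰 x π₀ hass hreg hmatch

/-- **The EXIT retyped through Hida's ordinary algebra** — `ProModularOrdinaryClassical` with its hypothesis
`∃ 𝒰, 𝒰.IsPadicallyAutomorphic ρ` replaced by: `ρ` is associated with a continuous `ℚ̄_p`-point of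
`𝕋^{S,ord}(𝒰)` at a tame level `𝒰` maximal above `p`, with finite-order slot-`0` diamond character (what a
Skinner–Wiles / Hida-family argument produces natively); conditional on the three printed Bianchi facts.  This is
the crux minus exactly its open transfer core (Galois-ordinary pro-modular ⇒ such a point). [folklore] -/
theorem ordinarilyProModularOrdinaryClassical : Literature.NumberTheory.Automorphic.hidaControl_dominantOrdinaryPoint → Literature.NumberTheory.Automorphic.bianchi_interiorEigenclass_isCuspidal → Literature.NumberTheory.Automorphic.bianchi_boundaryEigensystem_isReducible → ∀ (F : Type) [Field F] [NumberField F], NumberField.IsTotallyComplex F → Module.finrank ℚ F = 2 → ∀ (p : ℕ) [Fact p.Prime], p ≠ 2 → ∀ (hcpt : Literature.NumberTheory.Automorphic.isCompact_glFiniteIntegralLevel 2 F) (ι : PadicAlgCl p ≃+* ℂ) (ρ : Literature.NumberTheory.GaloisRepresentations.FramedGaloisRep F (PadicAlgCl p) 2), ρ.toGaloisRep.IsIrreducible → (∃ 𝒰 : Literature.NumberTheory.Automorphic.BigHeckeGLn.TameLevel 2 F p, 𝒰.IsMaximalAbove ∧ ∃ x : Literature.NumberTheory.Automorphic.OrdinaryHeckeAlgebraGLn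 𝒰 →+* PadicAlgCl p, Continuous x ∧ 𝒰.IsOrdAssociated x ρ ∧ ∃ N : ℕ, 0 < N ∧ ∀ (u : NumberField.RingOfIntegers F) (û : ∀ v : IsDedekindDomain.HeightOneSpectrum (NumberField.RingOfIntegers F), (p : NumberField.RingOfIntegers F) ∈ v.asIdeal → (v.adicCompletionIntegers F)ˣ), (∀ (v : IsDedekindDomain.HeightOneSpectrum (NumberField.RingOfIntegers F)) (hv : (p : NumberField.RingOfIntegers F) ∈ v.asIdeal), ((û v hv : v.adicCompletionIntegers F) : v.adicCompletion F) = algebraMap F (v.adicCompletion F) (u : F)) → (∏ᶠ v : {v : IsDedekindDomain.HeightOneSpectrum (NumberField.RingOfIntegers F) // (p : NumberField.RingOfIntegers F) ∈ v.asIdeal}, x (𝒰.ordDiamond v.2 (Pi.mulSingle (0 : Fin 2) (û v.1 v.2)))) ^ N = 1) → (∃ k : ℕ, 2 ≤ k ∧ ∃ m : ℕ, 0 < m ∧ ∀ v : IsDedekindDomain.HeightOneSpectrum (NumberField.RingOfIntegers F), (p : NumberField.RingOfIntegers F) ∈ v.asIdeal → ρ.IsOrdinaryOfWeightAt p v k m)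 → ∃ π : Literature.NumberTheory.Automorphic.CuspidalAutomorphicRepData 2 F hcpt, π.1.IsLAlgebraic ∧ ∀ᶠ v in Filter.cofinite, Summit.Langlands.SatakeFrobCompatibleAt ι π.1 ρ v := by
  intro hA hB hC F _ _ hF hdeg p _ hp hcpt ι ρ hirr hopm hord
  obtain ⟨𝒰, h𝒰, x, hx, hass, hslot⟩ := hopm
  obtain ⟨k, hk, m, hm, hv⟩ := hord
  exact classical_of_ordinaryPoint hA hB hC F hF hdeg p hp hcpt ι ρ 𝒰 x k m hirr h𝒰 hx hass hk hm hv hslot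

end Summit.Langlands.Langlands.Cruxes.ProModularOrdinaryClassical.TopDegreeExactControl
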